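import Literature.AlgebraicGeometry.HodgeTheory.CompleteIntersectionHodgeLocusCodim
import HarnessLib

/-!
# Kloosterman 2023, §2 eq. (1): the Hilbert function of a complete intersection ideal is the Koszul
# alternating sum — for EVERY regular sequence of forms in `K[x_0, …, x_n]`

R. Kloosterman, *Variational Hodge conjecture for complete intersections on hypersurfaces in projective
space*, Rend. Sem. Mat. Univ. Padova 148 (2023) 185–201 (= arXiv:2104.14845), §2, verbatim: "Let
`χ : ℤ → ℤ` be the Hilbert function of `X` with respect to `𝒪(1)`, defined by `χ(m) = dim S(X)_m`. For any
homogeneous ideal `I` of `S(X)` define the Hilbert function `h_I : ℤ_{≥0} → ℤ_{≥0}` of `I` by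
`h_I(m) = dim (S(X)/I)_m`. Fix a complete intersection ideal `I = (P_1, …, P_t)`, i.e., `P_1, …, P_t` form a
regular sequence of homogeneous elements of `S`. Let `d_i := deg(P_i)`. … Consider now the Koszul complex
associated with the map `⊕ S(−d_i) → S` given by `(P_1, …, P_t)` … This complex is exact since `(P_1, …, P_t)`
is a regular sequence. … the `a_{ij}` are the degrees of the products of the elements of subsets of `i`
distinct elements in `{P_1, …, P_t}`. By the above mentioned exact sequence we now find that for `m ≥ 0`
**(1)** `h_I(m) = χ(m) + Σ_{i=1}^t (−1)^i Σ_{j=1}^{k_i} χ(m − a_{ij})`. For `m' < 0` we have `χ(m') = 0`."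
[cite: Kloosterman2023, §2 eq. (1)]

The tree file `Kloosterman2023/CompleteIntersectionHodgeLoci.lean` names the right-hand side of (1) for
`X = ℙ^{v−1}` (`S = K[x_0, …, x_{v−1}]`, `χ_v(m) = binom(m+v−1, v−1)`): `koszulHilbert v [d_1, …, d_t] m`, and
checks (1) against the bounded-monomial count `ciHilbert` on the census rows by `decide`.

**What this file proves (0 facts, 0 sorry)**: eq. (1) itself, for `X = ℙ^n` over any field `K` and EVERY
regular sequence — for forms `G_0, …, G_{t−1}` of positive degrees `a_i` in `S = K[x_0, …, x_n]` (any
`t`, fewer or as many forms as variables) such that each `G_k` is a non-zero-divisor modulo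
`(G_0, …, G_{k−1})`:
* `hilbert_ofList_take_eq_koszulHilbert` / **`hilbert_span_eq_koszulHilbert`**:
  `dim_K (S/(G))_m = koszulHilbert (n+1) [a_0, …, a_{t−1}] m` for all `m ≥ 0` (as an integer identity), and
  `hilbert_span_eq_koszulHilbert_of_isWeaklyRegular` (Mathlib's `RingTheory.Sequence.IsWeaklyRegular`
  hypothesis). The proof is the printed one with the Koszul complex replaced by its two-term shadow: the
  exact sequence `0 → (S/I)_s —·Q→ (S/I)_{s+q} → (S/(I+(Q)))_{s+q} → 0` for a non-zero-divisor `Q` of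
  degree `q` (tree `hilbert_sup_span_add_hilbert_eq`, Philippon 1986 Lemme 3.1), i.e.
  `h_{I+(Q)}(m) = h_I(m) − h_I(m − q)`, matched with the recursion
  `koszulHilbert v (l ++ [q]) m = koszulHilbert v l m − koszulHilbert v l (m − q)` (`koszulHilbert_concat`;
  subsets containing / not containing the last generator), starting from `h_{(0)}(m) = χ(m)`
  (`koszulHilbert_nil_eq_chi`, `hilbert_bot_eq_chi`);
* consequently **eq. (1) = the box count for Artinian complete intersections in general**:
  `koszulHilbert (n+1) [a_0, …, a_n] m = ciHilbert [a_0, …, a_n] m` for all positive `a_i`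
  (`koszulHilbert_eq_ciHilbert`, via the monomial regular sequence `x_i^{a_i}` and the tree's
  `hilbert_span_X_pow_eq_ciHilbert`) — previously checked in the tree only on the census parameter lists.

HONEST FRAMING (cell pub-hlocus): certified instances and evidence bearing on the general Hodge conjecture;
no claim.

## References

* [Kloosterman2023] R. Kloosterman, *Variational Hodge conjecture for complete intersections on hypersurfaces
  in projective space*, Rend. Sem. Mat. Univ. Padova 148 (2023), §2 eq. (1).
* [Philippon1986] P. Philippon, *Lemmes de zéros dans les groupes algébriques commutatifs*, Bull. SMF 114
  (1986), Lemme 3.1.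
* [CarlsonMullerStachPeters2017] J. Carlson, S. Müller-Stach, C. Peters, *Period Mappings and Period
  Domains*, 2nd ed., CUP 2017, §7.4 (regular sequences, p. 219).
-/

noncomputable section

open MvPolynomial Module RingTheory.Sequence
open Literature.RingTheory.MvPolynomial Literature.AlgebraicGeometry.HodgeTheory

attribute [local instance] MvPolynomial.gradedAlgebra

namespace Literature.AlgebraicGeometry.Kloosterman2023

universe u

variable {K : Type u} [Field K]

/-! ### The right-hand side of eq. (1): base case and the recursion in the last generator -/

/-- "For `m' < 0` we have `χ(m') = 0`." [cite: Kloosterman2023, §2] -/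
theorem chi_of_neg (v : ℕ) {m : ℤ} (hm : m < 0) : chi v m = 0 := by
  simp [chi, not_le.mpr hm]

/-- `χ_{n+1}(m) = binom(m+n, n) = dim K[x_0, …, x_n]_m` for `m ≥ 0`. [cite: Kloosterman2023, §2] -/
theorem chi_natCast (n m : ℕ) : chi (n + 1) (m : ℤ) = ((m + n).choose n : ℕ) := by
  have h : (m : ℤ).toNat + (n + 1) - 1 = m + n := by
    rw [Int.toNat_natCast]
    omega
  unfold chi
  rw [if_pos (Int.natCast_nonneg m), h, Nat.add_sub_cancel]

/-- No generators: the alternating sum is `χ(m)`. [cite: Kloosterman2023, §2 eq. (1)] -/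
theorem koszulHilbert_nil_eq_chi (v m : ℕ) : koszulHilbert v [] m = chi v m := by
  simp [koszulHilbert]

/-- **Recursion of the Koszul alternating sum in the last generator**: the subsets of `{P_1, …, P_t, Q}`
either avoid `Q` or contain it, so `RHS(l ++ [q]; m) = RHS(l; m) − RHS(l; m − q)`, the second term being
absent (all its `χ`'s have negative argument) when `m < q`. [cite: Kloosterman2023, §2 eq. (1)] -/
theorem koszulHilbert_concat (v : ℕ) (l : List ℕ) (q m : ℕ) :
    koszulHilbert v (l ++ [q]) m =
      koszulHilbert v l m - if q ≤ m then koszulHilbert v l (m - q) else 0 := by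
  unfold koszulHilbert
  rw [List.sublists_concat, List.map_append, List.sum_append, List.map_map]
  by_cases hq : q ≤ m
  · -- the subsets containing the last generator contribute `−RHS(l; m − q)`
    have hterm : ∀ T ∈ l.sublists,
        ((fun T : List ℕ => (-1 : ℤ) ^ T.length * chi v ((m : ℤ) - (T.sum : ℕ))) ∘ fun T => T ++ [q]) T =
          (-1 : ℤ) * ((-1 : ℤ) ^ T.length * chi v (((m - q : ℕ) : ℤ) - (T.sum : ℕ))) := by
      intro T _
      have hlen : (T ++ [q]).length = T.length + 1 := by simp
      have hsum : (T ++ [q]).sum = T.sum + q := by simp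
      have hX : (m : ℤ) - ((T.sum + q : ℕ) : ℤ) = ((m - q : ℕ) : ℤ) - ((T.sum : ℕ) : ℤ) := by omega
      simp only [Function.comp_apply]
      rw [hlen, hsum, hX, pow_succ]
      ring
    rw [List.map_congr_left hterm, List.sum_map_mul_left, if_pos hq]
    ring
  · -- for `m < q` all these terms have `χ` of a negative argument
    have hterm : ∀ T ∈ l.sublists,
        ((fun T : List ℕ => (-1 : ℤ) ^ T.length * chi v ((m : ℤ) - (T.sum : ℕ))) ∘ fun T => T ++ [q]) T =
          0 := by
      intro T _
      have hsum : (T ++ [q]).sum = T.sum + q := by simp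
      simp only [Function.comp_apply]
      rw [hsum, chi_of_neg v (by omega), mul_zero]
    rw [List.map_congr_left hterm, if_neg hq, sub_zero]
    simp

/-! ### The Hilbert function side: `h_{(0)} = χ` and the non-zero-divisor recursion -/

/-- `h_{(0)}(m) = χ_{n+1}(m) = binom(m+n, n)` in `K[x_0, …, x_n]`. [cite: Kloosterman2023, §2] -/
theorem hilbert_bot_eq_chi (n m : ℕ) :
    ((finrank K (homogeneousSubmodule (Fin (n + 1)) K m) -
        finrank K (idealDegree (⊥ : Ideal (MvPolynomial (Fin (n + 1)) K)) m) : ℕ) : ℤ) = chi (n + 1) m := by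
  rw [finrank_homogeneousSubmodule_sub_finrank_idealDegree_bot, chi_natCast]
  have h : m + (n + 1) - 1 = m + n := by omega
  rw [h, Nat.choose_symm_add]

variable {n : ℕ}

/-- The components of `r · Q` below `deg Q` vanish. [folklore] -/
private theorem homogeneousComponent_mul_eq_zero_of_lt {Q : MvPolynomial (Fin (n + 1)) K} {q k : ℕ}
    (hQ : Q.IsHomogeneous q) (hk : k < q) (r : MvPolynomial (Fin (n + 1)) K) :
    homogeneousComponent k (r * Q) = 0 := by
  classical
  conv_lhs => rw [← sum_homogeneousComponent r, Finset.sum_mul, map_sum]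
  refine Finset.sum_eq_zero fun j _ => ?_
  have hmem : homogeneousComponent j r * Q ∈ homogeneousSubmodule (Fin (n + 1)) K (j + q) :=
    (homogeneousComponent_isHomogeneous j r).mul hQ
  rw [homogeneousComponent_of_mem hmem, if_neg (by omega)]

/-- Below the degree of the new generator nothing changes: `(I + (Q))_k = I_k` for `k < deg Q`. [folklore] -/
private theorem idealDegree_sup_span_singleton_of_lt {I : Ideal (MvPolynomial (Fin (n + 1)) K)}
    (hI : I.IsHomogeneous (homogeneousSubmodule (Fin (n + 1)) K)) {Q : MvPolynomial (Fin (n + 1)) K}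
    {q k : ℕ} (hQ : Q.IsHomogeneous q) (hk : k < q) :
    idealDegree (I ⊔ Ideal.span {Q}) k = idealDegree I k := by
  refine le_antisymm ?_ (idealDegree_mono le_sup_left k)
  rintro f ⟨hf, hfk⟩
  obtain ⟨i, hi, j, hj, rfl⟩ := Submodule.mem_sup.mp hf
  obtain ⟨r, rfl⟩ := Ideal.mem_span_singleton'.mp hj
  refine ⟨?_, hfk⟩
  rw [← homogeneousComponent_eq_self hfk, map_add, homogeneousComponent_mul_eq_zero_of_lt hQ hk r, add_zero]
  exact homogeneousComponent_mem_of_mem hI hi k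

/-- **The Koszul step in Hilbert-function form**: for a homogeneous ideal `I`, a form `Q ≠ 0` of degree `q`
which is a non-zero-divisor modulo `I`, and every `m ≥ 0`:
`h_{I+(Q)}(m) = h_I(m) − h_I(m − q)` (the last term read as `0` for `m < q`) — the exact sequence
`0 → (S/I)_{m−q} —·Q→ (S/I)_m → (S/(I+(Q)))_m → 0`. [cite: Philippon1986, Lemme 3.1]
[cite: Kloosterman2023, §2 (exactness of the Koszul complex)] -/
theorem hilbert_sup_span_eq_sub {I : Ideal (MvPolynomial (Fin (n + 1)) K)}
    (hI : I.IsHomogeneous (homogeneousSubmodule (Fin (n + 1)) K)) {Q : MvPolynomial (Fin (n + 1)) K}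
    (hQ0 : Q ≠ 0) {q : ℕ} (hQ : Q.IsHomogeneous q) (hnzd : ∀ f, Q * f ∈ I → f ∈ I) (m : ℕ) :
    ((finrank K (homogeneousSubmodule (Fin (n + 1)) K m) -
        finrank K (idealDegree (I ⊔ Ideal.span {Q}) m) : ℕ) : ℤ) =
      ((finrank K (homogeneousSubmodule (Fin (n + 1)) K m) - finrank K (idealDegree I m) : ℕ) : ℤ) -
        if q ≤ m then
          (((finrank K (homogeneousSubmodule (Fin (n + 1)) K (m - q)) -
            finrank K (idealDegree I (m - q)) : ℕ) : ℤ))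
        else 0 := by
  split_ifs with hq
  · obtain ⟨s, rfl⟩ : ∃ s, m = s + q := ⟨m - q, by omega⟩
    have h := hilbert_sup_span_add_hilbert_eq hI hQ0 hQ hnzd s
    rw [Nat.add_sub_cancel]
    omega
  · rw [idealDegree_sup_span_singleton_of_lt hI hQ (by omega), sub_zero]

/-! ### Regular sequences of forms `G_0, …, G_{t−1}` in `K[x_0, …, x_n]` -/

section Regular

variable {t : ℕ} (G : Fin t → MvPolynomial (Fin (n + 1)) K)

/-- `(G_0, …, G_{t−1})` as the ideal of the list `[G_0, …, G_{t−1}]`. [folklore] -/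
private theorem ofList_ofFn_eq_span : Ideal.ofList (List.ofFn G) = Ideal.span (Set.range G) := by
  unfold Ideal.ofList
  congr 1
  ext x
  exact List.mem_ofFn' G x

/-- `I_{k+1} = I_k + (G_k)`. [folklore] -/
private theorem ofList_take_succ {k : ℕ} (hk : k < t) :
    Ideal.ofList ((List.ofFn G).take (k + 1)) =
      Ideal.ofList ((List.ofFn G).take k) ⊔ Ideal.span {G ⟨k, hk⟩} := by
  rw [List.take_succ_eq_append_getElem (by simpa using hk), Ideal.ofList_append, Ideal.ofList_singleton,
    List.getElem_ofFn]

variable {G} {a : Fin t → ℕ}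

/-- `I_k` is homogeneous. [folklore] -/
private theorem isHomogeneous_ofList_take (hG : ∀ i, (G i).IsHomogeneous (a i)) (k : ℕ) :
    (Ideal.ofList ((List.ofFn G).take k)).IsHomogeneous (homogeneousSubmodule (Fin (n + 1)) K) := by
  refine Ideal.homogeneous_span _ _ fun x hx => ?_
  obtain ⟨i, rfl⟩ := (List.mem_ofFn' G x).mp (List.mem_of_mem_take hx)
  exact ⟨a i, hG i⟩

/-- Forms of positive degree have no constant term, so `1 ∉ I_k`. [folklore] -/
private theorem one_notMem_ofList_take (hG : ∀ i, (G i).IsHomogeneous (a i)) (ha : ∀ i, 0 < a i) (k : ℕ) :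
    (1 : MvPolynomial (Fin (n + 1)) K) ∉ Ideal.ofList ((List.ofFn G).take k) := by
  intro h1
  have hle : Ideal.ofList ((List.ofFn G).take k) ≤
      RingHom.ker (constantCoeff : MvPolynomial (Fin (n + 1)) K →+* K) := by
    refine Ideal.span_le.mpr fun x hx => ?_
    obtain ⟨i, rfl⟩ := (List.mem_ofFn' G x).mp (List.mem_of_mem_take hx)
    rw [SetLike.mem_coe, RingHom.mem_ker, constantCoeff_eq]
    exact (hG i).coeff_eq_zero (by rw [map_zero]; exact (ha i).ne)
  have := hle h1
  rw [RingHom.mem_ker, map_one] at this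
  exact one_ne_zero this

/-- A non-zero-divisor modulo a proper ideal is non-zero. [folklore] -/
private theorem ne_zero_of_regular (hG : ∀ i, (G i).IsHomogeneous (a i)) (ha : ∀ i, 0 < a i) {k : ℕ}
    (hk : k < t) (hreg : ∀ u : MvPolynomial (Fin (n + 1)) K,
      G ⟨k, hk⟩ * u ∈ Ideal.ofList ((List.ofFn G).take k) → u ∈ Ideal.ofList ((List.ofFn G).take k)) :
    G ⟨k, hk⟩ ≠ 0 := by
  intro h0
  refine one_notMem_ofList_take hG ha k (hreg 1 ?_)
  rw [h0, zero_mul]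
  exact Submodule.zero_mem _

/-- **Eq. (1) along the regular sequence**: for forms `G_0, …, G_{t−1}` of positive degrees `a_i` in
`K[x_0, …, x_n]`, each `G_k` a non-zero-divisor modulo `I_k = (G_0, …, G_{k−1})`, one has
`h_{I_k}(m) = koszulHilbert (n+1) [a_0, …, a_{k−1}] m` for every `k ≤ t` and every `m ≥ 0`.
[cite: Kloosterman2023, §2 eq. (1)] [cite: Philippon1986, Lemme 3.1] -/
theorem hilbert_ofList_take_eq_koszulHilbert (hG : ∀ i, (G i).IsHomogeneous (a i)) (ha : ∀ i, 0 < a i)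
    (hreg : ∀ (k : ℕ) (hk : k < t) (u : MvPolynomial (Fin (n + 1)) K),
      G ⟨k, hk⟩ * u ∈ Ideal.ofList ((List.ofFn G).take k) → u ∈ Ideal.ofList ((List.ofFn G).take k)) :
    ∀ k, k ≤ t → ∀ m : ℕ,
      ((finrank K (homogeneousSubmodule (Fin (n + 1)) K m) -
          finrank K (idealDegree (Ideal.ofList ((List.ofFn G).take k)) m) : ℕ) : ℤ) =
        koszulHilbert (n + 1) ((List.ofFn a).take k) m := by
  intro k
  induction k with
  | zero =>
    intro _ m
    rw [List.take_zero, List.take_zero, Ideal.ofList_nil, koszulHilbert_nil_eq_chi, hilbert_bot_eq_chi]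
  | succ k ih =>
    intro hk m
    have hk' : k < t := by omega
    have hka : k < (List.ofFn a).length := by simpa using hk'
    rw [ofList_take_succ G hk', List.take_succ_eq_append_getElem hka, List.getElem_ofFn,
      koszulHilbert_concat, hilbert_sup_span_eq_sub (isHomogeneous_ofList_take hG k)
        (ne_zero_of_regular hG ha hk' (hreg k hk')) (hG ⟨k, hk'⟩) (fun f hf => hreg k hk' f hf) m,
      ih hk'.le m]
    split_ifs with hq
    · rw [ih hk'.le (m - a ⟨k, hk'⟩)]
    · rfl

/-- **Kloosterman 2023, eq. (1), for every regular sequence of forms in `K[x_0, …, x_n]`**: if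
`G_0, …, G_{t−1}` are forms of positive degrees `a_0, …, a_{t−1}` and each `G_k` is a non-zero-divisor
modulo `(G_0, …, G_{k−1})`, then for every `m ≥ 0`
`h_{(G)}(m) = dim_K (S/(G))_m = Σ_{T ⊆ {0,…,t−1}} (−1)^{|T|} χ(m − Σ_{i∈T} a_i) = koszulHilbert (n+1) [a_i] m`,
`χ(m) = binom(m+n, n)`, `χ(m') = 0` for `m' < 0`. [cite: Kloosterman2023, §2 eq. (1)] -/
theorem hilbert_span_eq_koszulHilbert (hG : ∀ i, (G i).IsHomogeneous (a i)) (ha : ∀ i, 0 < a i)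
    (hreg : ∀ (k : ℕ) (hk : k < t) (u : MvPolynomial (Fin (n + 1)) K),
      G ⟨k, hk⟩ * u ∈ Ideal.ofList ((List.ofFn G).take k) → u ∈ Ideal.ofList ((List.ofFn G).take k))
    (m : ℕ) :
    ((finrank K (homogeneousSubmodule (Fin (n + 1)) K m) -
        finrank K (idealDegree (Ideal.span (Set.range G)) m) : ℕ) : ℤ) =
      koszulHilbert (n + 1) (List.ofFn a) m := by
  have h := hilbert_ofList_take_eq_koszulHilbert hG ha hreg t le_rfl m
  rwa [List.take_of_length_le (by simp), List.take_of_length_le (by simp), ofList_ofFn_eq_span] at h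

/-- **Eq. (1), Mathlib regular-sequence form**: the same for a weakly regular sequence
`[G_0, …, G_{t−1}]` on `S` (`RingTheory.Sequence.IsWeaklyRegular`). [cite: Kloosterman2023, §2 eq. (1)] -/
theorem hilbert_span_eq_koszulHilbert_of_isWeaklyRegular (hG : ∀ i, (G i).IsHomogeneous (a i))
    (ha : ∀ i, 0 < a i) (hreg : IsWeaklyRegular (MvPolynomial (Fin (n + 1)) K) (List.ofFn G)) (m : ℕ) :
    ((finrank K (homogeneousSubmodule (Fin (n + 1)) K m) -
        finrank K (idealDegree (Ideal.span (Set.range G)) m) : ℕ) : ℤ) =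
      koszulHilbert (n + 1) (List.ofFn a) m := by
  refine hilbert_span_eq_koszulHilbert hG ha (fun k hk u hu => ?_) m
  have hkl : k < (List.ofFn G).length := by simpa using hk
  have hw := (isSMulRegular_quotient_iff_mem_of_smul_mem _ _).mp (hreg.regular_mod_prev k hkl) u
  rw [Ideal.smul_eq_mul, Ideal.mul_top, smul_eq_mul, List.getElem_ofFn] at hw
  exact hw hu

end Regular

/-! ### Consequence: eq. (1) is the box count for every Artinian complete intersection -/

/-- **`koszulHilbert = ciHilbert` in general**: for positive degrees `a_0, …, a_n` (as many as variables),
the Koszul alternating sum of eq. (1) equals the bounded-monomial count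
`#{β ∈ ℕ^{n+1} : |β| = m, β_i ≤ a_i − 1}` in every degree `m` — both are the Hilbert function of the monomial
regular sequence `x_0^{a_0}, …, x_n^{a_n}` (tree `hilbert_span_X_pow_eq_ciHilbert`,
`mem_ofList_take_of_mul_mem`). [cite: Kloosterman2023, §2 eq. (1)] -/
theorem koszulHilbert_eq_ciHilbert (a : Fin (n + 1) → ℕ) (ha : ∀ i, 0 < a i) (m : ℕ) :
    koszulHilbert (n + 1) (List.ofFn a) m = ciHilbert (List.ofFn a) m := by
  have hX : ∀ i, (X i : MvPolynomial (Fin (n + 1)) ℚ) ^ (∑ j, a j + 1) ∈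
      Ideal.span (Set.range fun i : Fin (n + 1) => (X i : MvPolynomial (Fin (n + 1)) ℚ) ^ a i) := fun i =>
    (Ideal.span _).pow_mem_of_pow_mem (Ideal.subset_span ⟨i, rfl⟩)
      ((Finset.single_le_sum (f := a) (fun _ _ => Nat.zero_le _) (Finset.mem_univ i)).trans (Nat.le_succ _))
  have h := hilbert_span_eq_koszulHilbert (K := ℚ) (G := fun i : Fin (n + 1) => X i ^ a i) (a := a)
    (fun i => isHomogeneous_X_pow i (a i)) ha
    (fun k hk u hu => mem_ofList_take_of_mul_mem _ a (fun i => isHomogeneous_X_pow i (a i)) ha hX hk hu) m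
  rw [hilbert_span_X_pow_eq_ciHilbert a ha m] at h
  exact h.symm

/-- The census instance read through eq. (1): for EVERY Artinian complete intersection of multidegree
`(1,1,2,3,3,2)` in `K[x_0, …, x_5]` (Kloosterman's ideal `I` for a `CI(1,1,2)` in a quartic fourfold) the
printed formula gives `h_I(4) = 8`. [cite: Kloosterman2023, §2 eq. (1), Prop. 3.2] -/
theorem koszulHilbert_quarticFourfold_ci112 : koszulHilbert 6 [1, 1, 2, 3, 3, 2] 4 = 8 := by
  decide

end Literature.AlgebraicGeometry.Kloosterman2023
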